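import Summits.Ventures.PercRepro.Night2FatXUnloaded

/-!
# night-2: the numerics of the degenerate count for `N ≥ 9`

With one side point and two free points (family B1 with `(μ, φ) = (1, 2)`), the level-`k` family has
`C(m, k) − C(m − 1, k) − C(m − 3, k − 1) = C(m − 2, k − 2) + C(m − 3, k − 2)` members (Pascal,
**`choose_side_identity`**), increasing in `m`; at `m = 8` the levels `3 … 9` with the capacity `11/18` throughout give
`110/221 · (1 + 2/15 + 11/35 + 25/70 + 30/126 + 20/210 + 7/330 + 1/495) = 14978/13923 = 1.0758`:
**`numeric_deg_large`** — the degenerate regime's fair share for `N ≥ 9` needs no singleton and no second side point.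
Paper `proofs/NIGHT-2-g35.md` §2.
-/

namespace PercRepro.Shadow

/-- **Pascal, three steps**: `C(n+3, i+2) = C(n+2, i+2) + C(n, i+1) + C(n+1, i) + C(n, i)`. -/
theorem choose_side_identity (n i : ℕ) :
    (n + 3).choose (i + 2) = (n + 2).choose (i + 2) + n.choose (i + 1) + (n + 1).choose i + n.choose i := by
  have e1 : (n + 3).choose (i + 2) = (n + 2).choose (i + 1) + (n + 2).choose (i + 2) := Nat.choose_succ_succ' (n + 2) (i + 1)
  have e2 : (n + 2).choose (i + 1) = (n + 1).choose i + (n + 1).choose (i + 1) := Nat.choose_succ_succ' (n + 1) i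
  have e3 : (n + 1).choose (i + 1) = n.choose i + n.choose (i + 1) := Nat.choose_succ_succ' n i
  omega

/-- **The `(1, 2)` side family has `≥ C(m − 2, k − 2) + C(m − 3, k − 2)` members at level `k`**. -/
theorem choose_side_lower (m k s : ℕ) (hm : 3 ≤ m) (hk : 2 ≤ k)
    (hs : m.choose k ≤ s + (m - 1).choose k + (m - 3).choose (k - 1)) :
    (m - 2).choose (k - 2) + (m - 3).choose (k - 2) ≤ s := by
  obtain ⟨n, rfl⟩ : ∃ n, m = n + 3 := ⟨m - 3, by omega⟩
  obtain ⟨i, rfl⟩ : ∃ i, k = i + 2 := ⟨k - 2, by omega⟩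
  have := choose_side_identity n i
  rw [show n + 3 - 1 = n + 2 by omega, show n + 3 - 3 = n by omega, show i + 2 - 1 = i + 1 by omega] at hs
  rw [show n + 3 - 2 = n + 1 by omega, show n + 3 - 3 = n by omega, show i + 2 - 2 = i by omega]
  omega

/-- **The numerics of `N ≥ 9`** (`m = N − 1 ≥ 8`): with `s_k ≥ C(m, k) − C(m − 1, k) − C(m − 3, k − 1)` for
`k = 2, …, 8`, the levels `1, 3, …, 9` with the capacity `11/18` exceed `1` (`1.0758` at `m = 8`). -/
theorem numeric_deg_large (m : ℕ) (hm : 8 ≤ m) (s₂ s₃ s₄ s₅ s₆ s₇ s₈ : ℕ)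
    (h₂ : m.choose 2 ≤ s₂ + (m - 1).choose 2 + (m - 3).choose 1)
    (h₃ : m.choose 3 ≤ s₃ + (m - 1).choose 3 + (m - 3).choose 2)
    (h₄ : m.choose 4 ≤ s₄ + (m - 1).choose 4 + (m - 3).choose 3)
    (h₅ : m.choose 5 ≤ s₅ + (m - 1).choose 5 + (m - 3).choose 4)
    (h₆ : m.choose 6 ≤ s₆ + (m - 1).choose 6 + (m - 3).choose 5)
    (h₇ : m.choose 7 ≤ s₇ + (m - 1).choose 7 + (m - 3).choose 6)
    (h₈ : m.choose 8 ≤ s₈ + (m - 1).choose 8 + (m - 3).choose 7) :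
    (1 : ℚ) ≤ fatTerm 1 (11 / 18) + ((s₂ : ℚ) * fatTerm 3 (11 / 18) + (s₃ : ℚ) * fatTerm 4 (11 / 18) +
      (s₄ : ℚ) * fatTerm 5 (11 / 18) + (s₅ : ℚ) * fatTerm 6 (11 / 18) + (s₆ : ℚ) * fatTerm 7 (11 / 18) +
      (s₇ : ℚ) * fatTerm 8 (11 / 18) + (s₈ : ℚ) * fatTerm 9 (11 / 18)) := by
  have l₂ : (m - 2).choose 0 + (m - 3).choose 0 ≤ s₂ :=
    choose_side_lower m 2 s₂ (by omega) (by omega) h₂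
  have l₃ : (m - 2).choose 1 + (m - 3).choose 1 ≤ s₃ :=
    choose_side_lower m 3 s₃ (by omega) (by omega) h₃
  have l₄ : (m - 2).choose 2 + (m - 3).choose 2 ≤ s₄ :=
    choose_side_lower m 4 s₄ (by omega) (by omega) h₄
  have l₅ : (m - 2).choose 3 + (m - 3).choose 3 ≤ s₅ :=
    choose_side_lower m 5 s₅ (by omega) (by omega) h₅
  have l₆ : (m - 2).choose 4 + (m - 3).choose 4 ≤ s₆ :=
    choose_side_lower m 6 s₆ (by omega) (by omega) h₆
  have l₇ : (m - 2).choose 5 + (m - 3).choose 5 ≤ s₇ :=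
    choose_side_lower m 7 s₇ (by omega) (by omega) h₇
  have l₈ : (m - 2).choose 6 + (m - 3).choose 6 ≤ s₈ :=
    choose_side_lower m 8 s₈ (by omega) (by omega) h₈
  -- monotonicity in `m`
  have m2 : ∀ i, (6 : ℕ).choose i ≤ (m - 2).choose i := fun i => Nat.choose_le_choose i (by omega)
  have m3 : ∀ i, (5 : ℕ).choose i ≤ (m - 3).choose i := fun i => Nat.choose_le_choose i (by omega)
  have c₂ : 2 ≤ s₂ := by
    have a := m2 0
    have b := m3 0
    rw [show (6 : ℕ).choose 0 = 1 by rfl] at a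
    rw [show (5 : ℕ).choose 0 = 1 by rfl] at b
    omega
  have c₃ : 11 ≤ s₃ := by
    have a := m2 1
    have b := m3 1
    rw [show (6 : ℕ).choose 1 = 6 by rfl] at a
    rw [show (5 : ℕ).choose 1 = 5 by rfl] at b
    omega
  have c₄ : 25 ≤ s₄ := by
    have a := m2 2
    have b := m3 2
    rw [show (6 : ℕ).choose 2 = 15 by rfl] at a
    rw [show (5 : ℕ).choose 2 = 10 by rfl] at b
    omega
  have c₅ : 30 ≤ s₅ := by
    have a := m2 3
    have b := m3 3
    rw [show (6 : ℕ).choose 3 = 20 by rfl] at a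
    rw [show (5 : ℕ).choose 3 = 10 by rfl] at b
    omega
  have c₆ : 20 ≤ s₆ := by
    have a := m2 4
    have b := m3 4
    rw [show (6 : ℕ).choose 4 = 15 by rfl] at a
    rw [show (5 : ℕ).choose 4 = 5 by rfl] at b
    omega
  have c₇ : 7 ≤ s₇ := by
    have a := m2 5
    have b := m3 5
    rw [show (6 : ℕ).choose 5 = 6 by rfl] at a
    rw [show (5 : ℕ).choose 5 = 1 by rfl] at b
    omega
  have c₈ : 1 ≤ s₈ := by
    have a := m2 6
    have b := m3 6
    rw [show (6 : ℕ).choose 6 = 1 by rfl] at a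
    rw [show (5 : ℕ).choose 6 = 0 by rfl] at b
    omega
  have q₂ : (2 : ℚ) ≤ s₂ := by exact_mod_cast c₂
  have q₃ : (11 : ℚ) ≤ s₃ := by exact_mod_cast c₃
  have q₄ : (25 : ℚ) ≤ s₄ := by exact_mod_cast c₄
  have q₅ : (30 : ℚ) ≤ s₅ := by exact_mod_cast c₅
  have q₆ : (20 : ℚ) ≤ s₆ := by exact_mod_cast c₆
  have q₇ : (7 : ℚ) ≤ s₇ := by exact_mod_cast c₇
  have q₈ : (1 : ℚ) ≤ s₈ := by exact_mod_cast c₈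
  have p₃ : (0 : ℚ) ≤ fatTerm 3 (11 / 18) := by unfold fatTerm; positivity
  have p₄ : (0 : ℚ) ≤ fatTerm 4 (11 / 18) := by unfold fatTerm; positivity
  have p₅ : (0 : ℚ) ≤ fatTerm 5 (11 / 18) := by unfold fatTerm; positivity
  have p₆ : (0 : ℚ) ≤ fatTerm 6 (11 / 18) := by unfold fatTerm; positivity
  have p₇ : (0 : ℚ) ≤ fatTerm 7 (11 / 18) := by unfold fatTerm; positivity
  have p₈ : (0 : ℚ) ≤ fatTerm 8 (11 / 18) := by unfold fatTerm; positivity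
  have p₉ : (0 : ℚ) ≤ fatTerm 9 (11 / 18) := by unfold fatTerm; positivity
  have hnum : (1 : ℚ) ≤ fatTerm 1 (11 / 18) + (2 * fatTerm 3 (11 / 18) + 11 * fatTerm 4 (11 / 18) +
      25 * fatTerm 5 (11 / 18) + 30 * fatTerm 6 (11 / 18) + 20 * fatTerm 7 (11 / 18) +
      7 * fatTerm 8 (11 / 18) + 1 * fatTerm 9 (11 / 18)) := by
    unfold fatTerm
    norm_num [Nat.choose]
  nlinarith [mul_le_mul_of_nonneg_right q₂ p₃, mul_le_mul_of_nonneg_right q₃ p₄, mul_le_mul_of_nonneg_right q₄ p₅,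
    mul_le_mul_of_nonneg_right q₅ p₆, mul_le_mul_of_nonneg_right q₆ p₇, mul_le_mul_of_nonneg_right q₇ p₈,
    mul_le_mul_of_nonneg_right q₈ p₉]

end PercRepro.Shadow
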